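import Summits.QuantumFields.YangMills.Theorems.IsotropyFromPowerCountingTemperedCurvatureMomentsChartSelectionPart1

/-!
# Chart selection for three points of `ℝ⁴` — stub `stub_chartSelection`

Stub `stub_chartSelection` (D, pure geometry of the sixteen lattice mirrors) of reshape 4 of
`Cruxes/TemperedCurvatureMoments/Lines/Sketch.lean` (crux stmt-QuantumFields-17721), registered
signature verbatim.

Statement.  There is a universal `c > 0` such that every injective `y : Fin 3 → ℝ⁴` has a scale
`r > 0`, at least the distance of some pair, and TWO distinct GOOD slots `k`: either (axis clause)
`y_k` lies `≥ c r` above both other points along an oriented axis `s e_μ` and those two are `≥ c r`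
apart in coordinate `μ`, or (diagonal clause) there are four linearly independent directions `t_j`,
each the time direction `n = (s e_μ + s' e_ν)/√2` or the in-plane partner `v = (s e_μ - s' e_ν)/√2` of
an oriented diagonal frame in which `y_k` lies `≥ c r` above both other points.

Proof.  `r := d`, the minimal pairwise distance; `c := 8⁻³⁶/8`.
1. *Scale* (`ChartSelection.exists_scale`): a `θ ∈ [8⁻³⁶/2, 1/2]` such that every coordinate
   difference `|y_i^μ - y_j^μ|` is a TIE (`< θ d/8`) or SEPARATED (`≥ θ d`).  Every pair is separated
   in some coordinate (a coordinate carries half the distance `≥ d/2 ≥ θ d`).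
2. *Middle configurations* (`y_k^ν` between the two others with gaps `≥ θ d` on both sides): the two
   extreme slots satisfy the axis clause (`ChartSelection.axis_good`).
3. *No middle configuration.*  Then (`exists_sign_of_noMiddle`) for every slot `k` and coordinate
   `ν` some sign `s'` has `s' (y_k^ν - y_i^ν) ≥ -θ d/8` for both `i ≠ k` (otherwise `y_k^ν` is strictly
   between the others by more than a tie, hence by `≥ θ d`: a middle configuration), so every slot
   which is `θ d`-extreme in some coordinate satisfies the diagonal clause
   (`ChartSelection.diag_good`, margin `(θ d - θ d/8)/√2 ≥ c d`).  Finally (`extreme_or`) for each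
   pair `{p, q}`, separated in a coordinate `μ`, the position of the third point in `μ` (tie with `p`,
   tie with `q`, or separated from both) makes `p` or `q` extreme in `μ`; applied to the three pairs
   this yields two distinct extreme slots.

References: elementary; the sixteen-mirror chart method of crux 11687
(`CurvatureKernel.exists_good_frames`) made three-point. [folklore]
-/

noncomputable section

namespace Summit.QuantumFields.YangMills.Theorems.TemperedCurvatureMoments.Sketch

open scoped BigOperators
open Summit.QuantumFields.YangMills.Theorems.NPointIsotropy.Negative (E4)

namespace ChartSelection

/-- **Signs without a middle configuration.**  In coordinate `ν`, with the tie/separated dichotomy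
at `(b, a)`: if the slot `k` is not strictly between the two others with gaps `≥ a` on both sides,
then some sign `s' = ±1` has `s' (y_k^ν - y_i^ν) ≥ -b` for both `i ≠ k`. [folklore] -/
theorem exists_sign_of_noMiddle (y : Fin 3 → E4) (k : Fin 3) (ν : Fin 4) {a b : ℝ} (hb : 0 ≤ b)
    (hdich : ∀ i j, |y i ν - y j ν| < b ∨ a ≤ |y i ν - y j ν|)
    (hno : ¬ ∃ i i', i ≠ k ∧ i' ≠ k ∧ i ≠ i' ∧ a ≤ y k ν - y i ν ∧ a ≤ y i' ν - y k ν) :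
    ∃ s' : ℝ, (s' = 1 ∨ s' = -1) ∧ ∀ i, i ≠ k → -b ≤ s' * (y k ν - y i ν) := by
  by_contra h
  push Not at h
  obtain ⟨i, hik, hi⟩ := h 1 (Or.inl rfl)
  obtain ⟨i', hi'k, hi'⟩ := h (-1) (Or.inr rfl)
  rw [one_mul] at hi
  rw [neg_one_mul, neg_lt_neg_iff] at hi'
  apply hno
  refine ⟨i', i, hi'k, hik, ?_, ?_, ?_⟩
  · rintro rfl; linarith
  · rcases hdich k i' with h1 | h1
    · exact absurd (lt_of_le_of_lt (le_abs_self _) h1) (not_lt.2 hi'.le)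
    · rwa [abs_of_pos (lt_of_le_of_lt hb hi')] at h1
  · have hi2 : b < y i ν - y k ν := by linarith
    rcases hdich i k with h1 | h1
    · exact absurd (lt_of_le_of_lt (le_abs_self _) h1) (not_lt.2 hi2.le)
    · rwa [abs_of_pos (lt_of_le_of_lt hb hi2)] at h1

/-- **One of two separated slots is extreme.**  With the tie/separated dichotomy at `(b, a)`,
`2b ≤ a`, in coordinate `μ`: if `y_q^μ - y_p^μ ≥ a` then, according to the position of the third point
`o` (tie with `p` ⇒ `q` on top; tie with `q` ⇒ `p` at the bottom; separated from both ⇒ one of the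
two again), `q` is `a`-extreme with sign `+1` or `p` is `a`-extreme with sign `-1`. [folklore] -/
theorem extreme_or (y : Fin 3 → E4) {p q o : Fin 3} (hcov : ∀ i, i = p ∨ i = q ∨ i = o)
    (μ : Fin 4) {a b : ℝ} (hb : 0 ≤ b) (hab : 2 * b ≤ a)
    (hdich : ∀ i j, |y i μ - y j μ| < b ∨ a ≤ |y i μ - y j μ|) (hqp : a ≤ y q μ - y p μ) :
    (∃ (ν : Fin 4) (s : ℝ), (s = 1 ∨ s = -1) ∧ ∀ i, i ≠ q → a ≤ s * (y q ν - y i ν)) ∨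
    (∃ (ν : Fin 4) (s : ℝ), (s = 1 ∨ s = -1) ∧ ∀ i, i ≠ p → a ≤ s * (y p ν - y i ν)) := by
  suffices key : a ≤ y q μ - y o μ ∨ a ≤ y o μ - y p μ by
    rcases key with h | h
    · refine Or.inl ⟨μ, 1, Or.inl rfl, fun i hi => ?_⟩
      rw [one_mul]
      rcases hcov i with rfl | rfl | rfl
      exacts [hqp, absurd rfl hi, h]
    · refine Or.inr ⟨μ, -1, Or.inr rfl, fun i hi => ?_⟩
      rw [neg_one_mul, neg_sub]
      rcases hcov i with rfl | rfl | rfl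
      exacts [absurd rfl hi, hqp, h]
  rcases hdich o p with h1 | h1
  · have h1' := abs_lt.1 h1
    rcases hdich q o with h2 | h2
    · exfalso
      have h2' := abs_lt.1 h2
      linarith [h2'.2, h1'.2]
    · exact Or.inl (by rwa [abs_of_nonneg (by linarith [h1'.2])] at h2)
  · rcases hdich o q with h2 | h2
    · have h2' := abs_lt.1 h2
      exact Or.inr (by rwa [abs_of_nonneg (by linarith [h2'.1])] at h1)
    · rcases le_abs'.1 h2 with h3 | h3
      · exact Or.inl (by linarith)
      · exact Or.inr (by linarith)

end ChartSelection

open ChartSelection in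
/-- **Stub D `stub_chartSelection` (pure geometry of the sixteen lattice mirrors).**  There is `c > 0` such that every
injective triple `y` has a scale `r` (at least the distance of some pair) and TWO distinct GOOD slots `k`: either `y_k` lies
`c·r` above an `e_μ`-SEPARATED pair in an oriented axis frame `±e_μ` (⇒ time direction + three cone axes), or there are four
linearly independent directions `t_j`, each the time direction `n` or the in-plane partner `v` of an oriented diagonal frame
in which `y_k` lies `c·r` above the other two points.  Proof: pick `θ` on the ladder `{8^{-m}/2}` with no normalised
coordinate difference in `[θ/8, θ)`; a middle configuration (a point `θ r`-strictly between the two others in some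
coordinate) makes the two extreme slots good (axis); otherwise every slot which is `θ r`-extreme in some coordinate is
good (diagonals `s e_μ ± e_ν` over the other three `ν`, the partner direction completing the basis), and each pair,
being separated in some coordinate, has an extreme member, whence two distinct extreme slots. [folklore] -/
theorem stub_chartSelection :
    ∃ c : ℝ, 0 < c ∧ ∀ y : Fin 3 → E4, Function.Injective y →
      ∃ r : ℝ, 0 < r ∧ (∃ i j, i ≠ j ∧ dist (y i) (y j) ≤ r) ∧ ∃ k₁ k₂ : Fin 3, k₁ ≠ k₂ ∧
          ((∃ (μ : Fin 4) (s : ℝ), (s = 1 ∨ s = -1) ∧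
              (∀ i, i ≠ k₁ → inner ℝ (y i) (s • (EuclideanSpace.single μ (1 : ℝ) : E4)) + c * r ≤
                inner ℝ (y k₁) (s • (EuclideanSpace.single μ (1 : ℝ) : E4))) ∧
              (∀ i i', i ≠ k₁ → i' ≠ k₁ → i ≠ i' →
                c * r ≤ |inner ℝ (y i) (EuclideanSpace.single μ (1 : ℝ) : E4) - inner ℝ (y i') (EuclideanSpace.single μ (1 : ℝ) : E4)|)) ∨
            (∃ t : Fin 4 → E4, LinearIndependent ℝ t ∧ ∀ j, ∃ n v : E4, (∃ (μ ν : Fin 4) (s s' : ℝ), μ ≠ ν ∧ (s = 1 ∨ s = -1) ∧ (s' = 1 ∨ s' = -1) ∧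
            n = (Real.sqrt 2)⁻¹ • (s • (EuclideanSpace.single μ (1 : ℝ) : E4) + s' • (EuclideanSpace.single ν (1 : ℝ) : E4)) ∧
            v = (Real.sqrt 2)⁻¹ • (s • (EuclideanSpace.single μ (1 : ℝ) : E4) - s' • (EuclideanSpace.single ν (1 : ℝ) : E4))) ∧ (t j = n ∨ t j = v) ∧
              ∀ i, i ≠ k₁ → inner ℝ (y i) n + c * r ≤ inner ℝ (y k₁) n)) ∧
          ((∃ (μ : Fin 4) (s : ℝ), (s = 1 ∨ s = -1) ∧
              (∀ i, i ≠ k₂ → inner ℝ (y i) (s • (EuclideanSpace.single μ (1 : ℝ) : E4)) + c * r ≤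
                inner ℝ (y k₂) (s • (EuclideanSpace.single μ (1 : ℝ) : E4))) ∧
              (∀ i i', i ≠ k₂ → i' ≠ k₂ → i ≠ i' →
                c * r ≤ |inner ℝ (y i) (EuclideanSpace.single μ (1 : ℝ) : E4) - inner ℝ (y i') (EuclideanSpace.single μ (1 : ℝ) : E4)|)) ∨
            (∃ t : Fin 4 → E4, LinearIndependent ℝ t ∧ ∀ j, ∃ n v : E4, (∃ (μ ν : Fin 4) (s s' : ℝ), μ ≠ ν ∧ (s = 1 ∨ s = -1) ∧ (s' = 1 ∨ s' = -1) ∧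
            n = (Real.sqrt 2)⁻¹ • (s • (EuclideanSpace.single μ (1 : ℝ) : E4) + s' • (EuclideanSpace.single ν (1 : ℝ) : E4)) ∧
            v = (Real.sqrt 2)⁻¹ • (s • (EuclideanSpace.single μ (1 : ℝ) : E4) - s' • (EuclideanSpace.single ν (1 : ℝ) : E4))) ∧ (t j = n ∨ t j = v) ∧
              ∀ i, i ≠ k₂ → inner ℝ (y i) n + c * r ≤ inner ℝ (y k₂) n)) := by
  obtain ⟨c, hc0, hcdef⟩ : ∃ c : ℝ, 0 < c ∧ c = (1 / 8 : ℝ) ^ 36 / 2 / 4 :=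
    ⟨_, by positivity, rfl⟩
  refine ⟨c, hc0, fun y hy => ?_⟩
  obtain ⟨d, hd, hdle, hpair⟩ := exists_min_dist y hy
  refine ⟨d, hd, hpair, ?_⟩
  -- the scale
  obtain ⟨θ, hθ0, hθ1, hdich⟩ := exists_scale (fun i j μ => |y i μ - y j μ|) hd
  have hcθ : 4 * c ≤ θ := by rw [hcdef]; linarith
  have hθpos : 0 < θ := by linarith
  have hm0 : 0 ≤ c * d := by positivity
  have hmM : c * d ≤ θ * d := mul_le_mul_of_nonneg_right (by linarith) hd.le
  have hm2 : 2 * (c * d) ≤ θ * d - θ / 8 * d := by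
    have h := mul_le_mul_of_nonneg_right (show 2 * c ≤ θ - θ / 8 by linarith) hd.le
    linarith
  have hb0 : 0 ≤ θ / 8 * d := by positivity
  have hab : 2 * (θ / 8 * d) ≤ θ * d := by nlinarith
  -- every pair is separated in some coordinate
  have hsep : ∀ p q : Fin 3, p ≠ q → ∃ μ, θ * d ≤ |y p μ - y q μ| := fun p q hpq => by
    obtain ⟨μ, hμ⟩ := exists_coord_ge_half_dist (y p) (y q)
    exact ⟨μ, by linarith [mul_le_mul_of_nonneg_right hθ1 hd.le, hdle p q hpq]⟩
  by_cases hmid : ∃ (ν : Fin 4) (k i i' : Fin 3), i ≠ k ∧ i' ≠ k ∧ i ≠ i' ∧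
      θ * d ≤ y k ν - y i ν ∧ θ * d ≤ y i' ν - y k ν
  · -- a middle configuration: the two extreme slots are axis-good
    obtain ⟨ν, k, i, i', hik, hi'k, hii', h1, h2⟩ := hmid
    refine ⟨i', i, fun h => hii' h.symm, Or.inl ?_, Or.inl ?_⟩
    · exact axis_good y (cover3 i' k i hi'k (fun h => hii' h.symm) (fun h => hik h.symm)) ν
        (Or.inl rfl) hmM hm0 (by rw [one_mul]; exact h2) (by rw [one_mul]; exact h1)
    · exact axis_good y (cover3 i k i' hik hii' (fun h => hi'k h.symm)) ν
        (Or.inr rfl) hmM hm0 (by rw [neg_one_mul, neg_sub]; exact h1)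
        (by rw [neg_one_mul, neg_sub]; exact h2)
  · -- no middle configuration: extreme slots are diagonal-good, and two slots are extreme
    have hsign : ∀ (k : Fin 3) (ν : Fin 4), ∃ s' : ℝ, (s' = 1 ∨ s' = -1) ∧
        ∀ i, i ≠ k → -(θ / 8 * d) ≤ s' * (y k ν - y i ν) := fun k ν =>
      exists_sign_of_noMiddle y k ν hb0 (fun i j => hdich i j ν)
        (fun ⟨i, i', h⟩ => hmid ⟨ν, k, i, i', h⟩)
    have hE : ∀ p q : Fin 3, p ≠ q →
        (∃ (μ : Fin 4) (s : ℝ), (s = 1 ∨ s = -1) ∧ ∀ i, i ≠ q → θ * d ≤ s * (y q μ - y i μ)) ∨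
        (∃ (μ : Fin 4) (s : ℝ), (s = 1 ∨ s = -1) ∧ ∀ i, i ≠ p → θ * d ≤ s * (y p μ - y i μ)) := by
      intro p q hpq
      obtain ⟨μ, hμ⟩ := hsep p q hpq
      obtain ⟨o, hpo, hqo⟩ := third3 p q hpq
      rcases le_abs'.1 hμ with h | h
      · exact extreme_or y (cover3 p q o hpq hpo hqo) μ hb0 hab (fun i j => hdich i j μ)
          (by linarith)
      · exact (extreme_or y (cover3 q p o hpq.symm hqo hpo) μ hb0 hab (fun i j => hdich i j μ)
          (by linarith)).symm
    rcases hE 1 0 (by decide) with h0 | h1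
    · obtain ⟨μ0, s0, hs0, hk0⟩ := h0
      rcases hE 2 1 (by decide) with h1 | h2
      · obtain ⟨μ1, s1, hs1, hk1⟩ := h1
        exact ⟨0, 1, by decide, Or.inr (diag_good y 0 μ0 hs0 hm0 hm2 hk0 (hsign 0)),
          Or.inr (diag_good y 1 μ1 hs1 hm0 hm2 hk1 (hsign 1))⟩
      · obtain ⟨μ2, s2, hs2, hk2⟩ := h2
        exact ⟨0, 2, by decide, Or.inr (diag_good y 0 μ0 hs0 hm0 hm2 hk0 (hsign 0)),
          Or.inr (diag_good y 2 μ2 hs2 hm0 hm2 hk2 (hsign 2))⟩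
    · obtain ⟨μ1, s1, hs1, hk1⟩ := h1
      rcases hE 2 0 (by decide) with h0 | h2
      · obtain ⟨μ0, s0, hs0, hk0⟩ := h0
        exact ⟨1, 0, by decide, Or.inr (diag_good y 1 μ1 hs1 hm0 hm2 hk1 (hsign 1)),
          Or.inr (diag_good y 0 μ0 hs0 hm0 hm2 hk0 (hsign 0))⟩
      · obtain ⟨μ2, s2, hs2, hk2⟩ := h2
        exact ⟨1, 2, by decide, Or.inr (diag_good y 1 μ1 hs1 hm0 hm2 hk1 (hsign 1)),
          Or.inr (diag_good y 2 μ2 hs2 hm0 hm2 hk2 (hsign 2))⟩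

end Summit.QuantumFields.YangMills.Theorems.TemperedCurvatureMoments.Sketch

end
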